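import Summits.ResolutionOfSingularities.ResolutionOfSingularities.Theorems.MarkedTransferCampaignW36Thm614Part1OnClass
import Literature.AlgebraicGeometry.Hironaka2017.Proofs.S06BaseHike.SingRegularOfEmbcodimLe
import HarnessLib

/-!
# [OURS · L1 W3.6 ↔ GAP-LEDGER R20 sub 20a] 20a IS EXACT BY NAME AT CLASS LEVEL, MODULO SEAT 2's ONE-SIDED DIMENSION BINDER ⟨hdimle⟩:
# on every sub-class of the W3.6 door's class (guarded by `DimUscClosureClass`), `CampaignW36.Thm614Part1On 𝒞` («Th. 6.14 (1) at EVERY typed core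
# focus of every realized member») ⟺ `CampaignW36.HatClosureRegularOn 𝒞` (⟨HatClosureRegular⟩ = ⟨SingRegular(Ě)⟩ on the class) — and the DNF-half
# carrier: ONE realized member (same guard) with SINGULAR `Σ̄_max(Ê)` refutes `Thm614Part1On 𝒞` / both of its `p`-slices

Cell `res-hironaka` (run/shared/lean/pub/res-hironaka/), rung L (rescue), row L-G3, slot W3.6 ↔ GAP-LEDGER R20. Typed by the OURS typer o4 (statement-only
lane); fourth file of the series p498576 `…W36SingRegularBridge` (⟨HatClosureRegular⟩ ⟺ ⟨SingRegular(Ě)⟩, class `RegularClosureClass`) / p499800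
`…W36SingLCIBridge` / p501108 `…W36Thm614Part1OnClass` (`CampaignW36.Thm614Part1On 𝒞`, its R1/R2 `p`-slices, the SEAT-1 composition). HOST (custody,
no new route): `--supports stmt-ResolutionOfSingularities-16155 --as helper`.

WHY (records on the cell's STATUS.md). SEAT 2 of the G3 +2 naming line (res-D-pv-027 AS res-L1-s36-pv-4) LANDED the instance-level EXACTNESS of
⟨SingRegular(Ě)⟩ for the typed Th. 6.14 (1): p502486 `S06BaseHike.Thm6_14_1_iff_isRegular_sing` (+ `_R1`, `_R2`; ⇐ = p493712) under a local-
equidimensionality binder `hequi`, then p503626 `SingRegularOfEmbcodim` (no binder for IRREDUCIBLE `Sing(Ě)`: `ringKrullDim_quotient_stalkIdeal_eq_of_irreducible`)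
and p504522 `SingRegularOfEmbcodimLe` — `isRegular_sing_of_Thm6_14_1_of_dim_le`: the binder WEAKENED to the one-sided `hdimle` «near every closed `P ∈ Sing(Ě)`
the closed-point local dimension `dim 𝒪_η/𝓘_η` does not exceed the one at `P`» (`hdimle_of_hequi`); SEAT 2's ERRATUM 06:19:47Z: this binder is a PROOF
ARTIFACT, expected TRUE for every closed `C ⊆ Z` ([reading]: finitely many irreducible components, those through closed points near `P` pass through `P`) but
with NO kernel in the tree — «the honest residual of the converse is ⟨hdimle⟩, a general fact about `Z` awaiting a kernel, not a condition on `Ě`». res-adj-3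
RE-CITE R20/20a 05:43:43Z (3)(b) / 06:00:56Z #2 («20a modulus KERNEL-EXACT»); pending trigger «o4 negation carriers (20a DNF sub-entry @instance + CLASS ask)»
(CUSTODIAL 05:44:50Z). A `Literature.*` module cannot import `Summits.*`, so the class-level reading of SEAT 2's theorems — in the binder shape of the W3.6
Hat-on-class family (p487786) and of p501108's `Thm614Part1On` — can only be composed here. This file:
* §1 names the binders as CLASS GUARDS in p487786's idiom `𝒞 Ê Σ_max` (generic over schemes): `DimUscOn C` (SEAT 2's `hdimle` for a closed `C`),
  `DimUscClosureClass F Σ := DimUscOn Σ̄`, `IrreducibleClosureClass F Σ := IrreducibleSpace V(𝓘_Σ̄)` (p503626's binder), the class-former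
  `DimUscPart 𝒞 := 𝒞 ∧ DimUscClosureClass`; on ambient data `Irreducible ⇒ DimUsc` (SEAT 2's lemma by name);
* §2 reads them at a typed core focus: `Σ̄_max(Ê) = ⟨Sing Ě⟩` (p498576 §1) turns `DimUscClosureClass Ê Σ_max` into SEAT 2's `hdimle` for `Ě` VERBATIM;
* §3 EXACTNESS ON THE CLASS: for every `𝒞` inside `DimUscClosureClass` (at the ambient scheme), every input provenance `IsEdgeData`, every reading
  `IsEdgeData'` of the produced data implied by R1 ∧ R2 (`hread`, p493712) with degree-one spanning (`hspan`, p502486), and the door `CoreFocusExistsOn 𝒞`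
  (p487786; PROVED on `LCIOrMonomialClass`, p494780): `Thm614Part1On 𝒞 ⟺ HatClosureRegularOn 𝒞 ⟺ CoreFocusSingRegularOn 𝒞`; NECESSITY needs no door
  when read per core focus (`isRegular_sing_of_thm614Part1On`);
* §4 the DNF-HALF CARRIER BY NAME: one realized member `(E, ed)` of `𝒞` (standard, `0 < Ê.b`, certified) with `DimUscClosureClass Ê Σ_max` and a typed
  core focus whose `Sing(Ě)` is NOT regular — equivalently `¬⟨HatClosureRegular⟩` at `(Ê, ed)` when `Ě` comes from the door — gives `¬ Thm614Part1On 𝒞`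
  and, binder-free, `¬ CampaignW36Thm614Part1OnI 𝒞 p ∧ ¬ CampaignW36Thm614Part1OnR2I 𝒞 p` (`not_campaignW36Thm614Part1OnI_of_member`,
  `…_of_singular_closure`, `…_lciClass_of_singular_closure` = the shape SEAT 1 (res-D-pv-034 AS res-L1-s36-pv-3) instantiates at its cross
  `Ê = ((z² + x³y³)·O, 2)` on `𝔸³_K`, `char K = 2`, `Σ̄_max = V(z, xy)`; F1 `CrossSpecimen` p503530 landed; its other road is direct, through p500210);
* §5 the `p`-SLICES: `CampaignW36Thm614Part1OnI 𝒞 p ↔ CampaignW36HatClosureRegularOnI 𝒞 p` (and R2I, and `↔ CampaignW36CoreFocusSingRegularOnI 𝒞 p` by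
  p498576's bridge) for every `𝒞 ≤ DimUscClosureClass` carrying the door; UNCONDITIONAL on `DimUscPart 𝒞` for every `𝒞 ≤ LCIOrMonomialClass` (so on
  `DimUscPart LCIClass`) and on every `𝒞 ≤ IrreducibleClosureClass ⊓ LCIOrMonomialClass`.
NET FOR THE WORD (res-adj-3's to say): 20a and ⟨SingRegular⟩ are ONE named premise, in both readings of the produced data, on every sub-class of the door's
class — MODULO the class guard ⟨DimUsc⟩ = SEAT 2's ⟨hdimle⟩ (discharged for irreducible `Σ̄_max`; expected everywhere). When a kernel `∀ C, DimUscOn C` on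
ambient data (or res-adj-3's T-ASK k5, `hdimle` from Th. 6.14 (1) itself) lands, every `hle`/`hdimle` binder below is discharged by one term — a pure append.

HONEST FRAMING. Every declaration below is OURS (a campaign statement about OUR typed objects) or kernel plumbing over typed carriers; NOTHING here
is a statement of H. Hironaka's manuscript (2017-03-23, [Hironaka2017], lit key `paper:url-3343fd9e678b`), nothing asserts that Th. 6.14 (1) p.34
l.11–17 holds or fails as printed; `Thm6_14_1` is row 040a's TYPED CANDIDATE (res-type-040), entering only inside the class predicate `Thm614Part1On`
(a HYPOTHESIS row, never a modulus of record — rider R2 of 04:56:11Z kept); dimension / irreducibility / regularity / l.c.i. guards on `Σ̄_max` are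
printed nowhere in §6. The typed candidates `IsCoreFocus(_inst)`, `baseHike`, `EdgeDataOn`, `IsEdgeDataOn`, `invField` / `invInst`,
`S04CharAlgebra.pAlg`, `IsEdgeData`, `IsEdgeData_alg` are carriers / hypotheses / readings only. AI typing, weaker than expert review.

## Vacuity self-check (T-lint; for the lanes)
* `DimUscOn C` / `DimUscClosureClass F Σ`: as TYPED (any scheme `W`) NOT trivially true — a closed union of infinitely many components of growing
  dimension accumulating at a point violates it — but on the AMBIENT DATA (Noetherian, finite type over `K`) it is EXPECTED TRUE for every closed `C`
  (SEAT 2's reading 06:19:47Z; NO kernel in the tree): DISCLOSED — the guard names the proof artifact ⟨hdimle⟩ of record, it is not a restriction on `Ě`;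
  PROVED instances: every IRREDUCIBLE `C` (`dimUscOn_of_irreducibleSpace`, this file); SEAT 1's cross (two lines, dimension `1` at every closed point) is
  expected in, not certified here. NOT trivially false (the irreducible case). Vacuously true at `Σ = ∅` (disclosed; for `0 < Ê.b` the door's
  `Σ̄_max(Ê) = Sing(Ě) ≠ ∅`, p485977).
* `IrreducibleClosureClass F Σ`: NOT trivially true (the cross; FALSE at `Σ = ∅` — the empty scheme is not an `IrreducibleSpace`, disclosed); NOT
  trivially false (specimen (A)'s cusp `V(z, y² − x³)`, uncertified as a member here). `DimUscPart 𝒞`: a sub-class of `𝒞`, inherits the disclosures.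
* §3/§5 equivalences are between two HYPOTHESIS-shape class Props; both sides are THEOREMS on `RegularClosureClass` (p498576/p501108) and both are
  pre-declared to FAIL on `DimUscPart LCIClass` at `p = 2` once SEAT 1 certifies its cross (§4 is the carrier) — so neither iff is `True ↔ True`
  or `False ↔ False` by construction of the class alone; they are CONDITIONAL on the guard ⟨DimUsc⟩ exactly as SEAT 2's converse is on ⟨hdimle⟩.
Reference (context only, not a premise): H. Hironaka, ms. 2017-03-23, §6.3 Th. 6.14 (1) p.34 l.11–17; §6.2 Eq. (43) p.30 l.4–9. [Hironaka2017]
-/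

noncomputable section

set_option linter.dupNamespace false -- mandated namespace of this single-conjunct summit

open _root_.AlgebraicGeometry _root_.TopologicalSpace
namespace Summit.ResolutionOfSingularities.ResolutionOfSingularities.Theorems

open Literature.AlgebraicGeometry.Resolution Literature.AlgebraicGeometry.Hironaka2017
open Literature.AlgebraicGeometry.Hironaka2017.S02Preliminaries Literature.AlgebraicGeometry.Hironaka2017.S04CharAlgebra
open Literature.AlgebraicGeometry.Hironaka2017.S06BaseHike Literature.AlgebraicGeometry.Hironaka2017.Datum
open Scheme.IdealSheafData IsLocalRing

universe u

namespace CampaignW36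

/-! ## §1 The class guards -/
section Guards

/-- **[OURS · L1 W3.6 ↔ R20 20a] `CampaignW36.DimUscOn C` — «the closed-point LOCAL DIMENSION of the closed set `C ⊆ W` does not jump UP near any
closed point» (upper semicontinuity of `η ↦ dim 𝒪_{W,η}/𝓘_{C,η}` on `C_cl`)**: replaces the role of nothing printed (no dimension hypothesis on `Σ̄_max` /
`Sing(Ě)` appears in §6); NOT a statement of the manuscript. It is SEAT 2's ONE-SIDED binder `hdimle` of p504522
`S06BaseHike.isRegular_sing_of_Thm6_14_1_of_dim_le` (the weakening of p502486's `hequi`, `hdimle_of_hequi`), NAMED, for an arbitrary closed subset `C` of a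
scheme `W`: every closed `P ∈ C` has an open `U ∋ P` with `dim 𝒪_{W,η}/𝓘_{C,η} ≤ dim 𝒪_{W,P}/𝓘_{C,P}` for all closed `η ∈ U ∩ C` (`𝓘_C = vanishingIdeal C`,
the radical ideal sheaf of `C`; `stalkIdeal` its stalk). STATUS (SEAT 2's ERRATUM 2026-08-27T06:19:47Z, a [reading], not a kernel): expected to hold for
EVERY closed `C` of the ambient scheme (finitely many irreducible components; those through closed `η` near `P` pass through `P`) — so as a guard it is the
PROOF ARTIFACT of record awaiting a general kernel, not a condition on `Ě`; proved here for irreducible `C` only (`dimUscOn_of_irreducibleSpace`). [folklore] -/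
def DimUscOn {W : Scheme.{u}} (C : Closeds W) : Prop :=
  ∀ P ∈ (C : Set W), P ∈ S02Preliminaries.closedPoints W → ∃ U : W.Opens, P ∈ U ∧
    ∀ η ∈ U, η ∈ S02Preliminaries.closedPoints W → η ∈ (C : Set W) →
      ringKrullDim (W.presheaf.stalk η ⧸ stalkIdeal (vanishingIdeal C) η) ≤
        ringKrullDim (W.presheaf.stalk P ⧸ stalkIdeal (vanishingIdeal C) P)

/-- **[OURS · L1 W3.6 ↔ R20 20a] the class `CampaignW36.DimUscClosureClass`** — `(F, Σ) ↦` «the closure `Σ̄` of the stratum `Σ` has upper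
semicontinuous closed-point local dimension» (`DimUscOn (Closeds.closure Σ)`), in p487786's class idiom `𝒞 Ê Σ_max`. Replaces the role of nothing
printed; NOT a statement of the manuscript. At a typed core focus it IS SEAT 2's `hdimle` for `Ě` (`dimUscClosureClass_iff_of_isCoreFocus`, §2): the
side condition of record under which ⟨SingRegular(Ě)⟩ is EXACT for the typed Th. 6.14 (1). Vacuously true at `Σ = ∅`. [folklore] -/
def DimUscClosureClass ⦃W : Scheme.{u}⦄ (_ : IdealExponent W) (Sig : Set W) : Prop :=
  DimUscOn (Closeds.closure Sig)

/-- **[OURS · L1 W3.6 ↔ R20 20a] the class `CampaignW36.IrreducibleClosureClass`** — `(F, Σ) ↦` «`Σ̄` with its reduced closed-subscheme structure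
`V(𝓘_Σ̄)` is an IRREDUCIBLE space» (SEAT 2's binder `[IrreducibleSpace (vanishingIdeal C).subscheme]` of
`S06BaseHike.ringKrullDim_quotient_stalkIdeal_eq_of_irreducible` / `isRegular_sing_of_Thm6_14_1_of_irreducible`, NAMED at class level). Replaces
the role of nothing printed; NOT a statement of the manuscript. On ambient data it lies inside `DimUscClosureClass`
(`dimUscClosureClass_of_irreducibleClosureClass`). FALSE at `Σ = ∅` (the empty scheme is not irreducible). [folklore] -/
def IrreducibleClosureClass ⦃W : Scheme.{u}⦄ (_ : IdealExponent W) (Sig : Set W) : Prop :=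
  IrreducibleSpace (vanishingIdeal (Closeds.closure Sig)).subscheme

/-- **[OURS · L1 W3.6 ↔ R20 20a] the class-former `CampaignW36.DimUscPart 𝒞`** — «the part of the class `𝒞` whose `Σ̄_max` has upper semicontinuous
local dimension»: `(F, Σ) ↦ 𝒞 F Σ ∧ DimUscClosureClass F Σ`. Replaces the role of nothing printed; NOT a statement of the manuscript. The sub-class of `𝒞`
on which §3/§5 make 20a and ⟨HatClosureRegular⟩ ONE premise (expected to be all of `𝒞`, SEAT 2's reading; proved for irreducible `Σ̄_max`). [folklore] -/
def DimUscPart (𝒞 : ∀ ⦃W : Scheme.{u}⦄, IdealExponent W → Set W → Prop) ⦃W : Scheme.{u}⦄ (F : IdealExponent W)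
    (Sig : Set W) : Prop :=
  𝒞 F Sig ∧ DimUscClosureClass F Sig

/-- `DimUscPart` is monotone in the class (and `DimUscPart 𝒞 ≤ 𝒞`, `≤ DimUscClosureClass` by `.1` / `.2`). [folklore] -/
theorem dimUscPart_mono {𝒞 𝒟 : ∀ ⦃W : Scheme.{u}⦄, IdealExponent W → Set W → Prop}
    (hle : ∀ ⦃W⦄ (F : IdealExponent W) (S : Set W), 𝒞 F S → 𝒟 F S) ⦃W : Scheme.{u}⦄ (F : IdealExponent W) (Sig : Set W)
    (h : DimUscPart 𝒞 F Sig) : DimUscPart 𝒟 F Sig :=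
  ⟨hle _ _ h.1, h.2⟩

variable {p : ℕ} [Fact p.Prime] {K : Type u} [Field K] [CharP K p]

/-- **Irreducible ⇒ `DimUscOn`, on the ambient datum** (SEAT 2's p503626 `ringKrullDim_quotient_stalkIdeal_eq_of_irreducible` by name: `V(𝓘_C)`
integral of finite type over `K` has ONE local dimension at all closed points; take `U = ⊤`). [folklore] -/
theorem dimUscOn_of_irreducibleSpace (A : AmbientDatum p K) (C : Closeds A.Z)
    [IrreducibleSpace (vanishingIdeal C).subscheme] : DimUscOn C :=
  fun _ hP hPcl =>
    ⟨⊤, trivial, fun _ _ hηcl hη => (ringKrullDim_quotient_stalkIdeal_eq_of_irreducible A C hη hηcl hP hPcl).le⟩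

/-- **`IrreducibleClosureClass ≤ DimUscClosureClass` on every ambient datum.** [folklore] -/
theorem dimUscClosureClass_of_irreducibleClosureClass (A : AmbientDatum p K) (F : IdealExponent A.Z) (Sig : Set A.Z)
    (h : IrreducibleClosureClass F Sig) : DimUscClosureClass F Sig := by
  haveI : IrreducibleSpace (vanishingIdeal (Closeds.closure Sig)).subscheme := h
  exact dimUscOn_of_irreducibleSpace A (Closeds.closure Sig)

end Guards

/-! ## §2 The guards at a typed core focus: `Σ̄_max(Ê) = ⟨Sing Ě⟩` -/
section PerInstance

variable {p : ℕ} [Fact p.Prime] {K : Type u} [Field K] [CharP K p] {n : ℕ}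

/-- **`DimUscClosureClass Ê Σ_max` IS SEAT 2's `hdimle` for `Ě`**, for every typed core focusing `Ě` of `Ê` (any reading `inv`):
`Σ̄_max(Ê) = ⟨Sing Ě⟩` (p498576 `CampaignW31.invmaxClosure_eq_sing_of_isCoreFocus`). Kernel plumbing over typed carriers; NOT a statement of the
manuscript. [folklore] -/
theorem dimUscClosureClass_iff_of_isCoreFocus (A : AmbientDatum p K) (inv : IdealExponent A.Z → A.Z → EdgeInv n)
    (Ehat : IdealExponent A.Z) {Echeck : IdealExponent A.Z} (h : IsCoreFocus S04CharAlgebra.pAlg inv Ehat Echeck) :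
    DimUscClosureClass Ehat (invmaxStratum (Ehat.sing ∩ S02Preliminaries.closedPoints A.Z) (inv Ehat)) ↔
      DimUscOn (⟨Echeck.sing, A.isClosed_sing Echeck⟩ : Closeds A.Z) := by
  show DimUscOn (CampaignW31.invmaxClosure (Ehat.sing ∩ S02Preliminaries.closedPoints A.Z) (inv Ehat)) ↔ _
  rw [CampaignW31.invmaxClosure_eq_sing_of_isCoreFocus A inv Ehat h]

/-- `_inst` form (row 010d's instantiation of record, reading `invField Ê ed`). Kernel plumbing; NOT a statement of the manuscript. [folklore] -/
theorem dimUscClosureClass_iff_of_isCoreFocus_inst (A : AmbientDatum p K) (Ehat : IdealExponent A.Z)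
    (ed : EdgeDataOn p n Ehat) {Echeck : IdealExponent A.Z} (h : IsCoreFocus_inst Ehat Echeck ed) :
    DimUscClosureClass Ehat (invmaxStratum (Ehat.sing ∩ S02Preliminaries.closedPoints A.Z) (invField Ehat ed)) ↔
      DimUscOn (⟨Echeck.sing, A.isClosed_sing Echeck⟩ : Closeds A.Z) :=
  dimUscClosureClass_iff_of_isCoreFocus A (invInst Ehat ed) Ehat h

/-- **`IrreducibleClosureClass Ê Σ_max` IS SEAT 2's irreducibility binder for `Sing(Ě)`**, for every typed core focusing (any `inv`). Kernel
plumbing; NOT a statement of the manuscript. [folklore] -/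
theorem irreducibleClosureClass_iff_of_isCoreFocus (A : AmbientDatum p K) (inv : IdealExponent A.Z → A.Z → EdgeInv n)
    (Ehat : IdealExponent A.Z) {Echeck : IdealExponent A.Z} (h : IsCoreFocus S04CharAlgebra.pAlg inv Ehat Echeck) :
    IrreducibleClosureClass Ehat (invmaxStratum (Ehat.sing ∩ S02Preliminaries.closedPoints A.Z) (inv Ehat)) ↔
      IrreducibleSpace (vanishingIdeal (⟨Echeck.sing, A.isClosed_sing Echeck⟩ : Closeds A.Z)).subscheme := by
  show IrreducibleSpace (vanishingIdeal
      (CampaignW31.invmaxClosure (Ehat.sing ∩ S02Preliminaries.closedPoints A.Z) (inv Ehat))).subscheme ↔ _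
  rw [CampaignW31.invmaxClosure_eq_sing_of_isCoreFocus A inv Ehat h]

end PerInstance

/-! ## §3 Exactness on the class -/
section Exact

variable {𝒞 : ∀ ⦃W : Scheme.{u}⦄, IdealExponent W → Set W → Prop}
  {IsEdgeData IsEdgeData' : ∀ ⦃X : Scheme.{u}⦄ ⦃p n : ℕ⦄ (E : IdealExponent X) (ξ : X), EdgeDatumAt p n E ξ → Prop}
  {p : ℕ} [Fact p.Prime] {K : Type u} [Field K] [CharP K p] [PerfectField K] {A : AmbientDatum p K} {n : ℕ}

/-- **NECESSITY, per core focus (no door needed)**: if 20a holds on a class `𝒞` whose members (at this ambient scheme) lie in `DimUscClosureClass`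
(`hle`), the produced data being read in a provenance `IsEdgeData'` with degree-one spanning (`hspan`: R1 `degOneSpan_of_isEdgeData`, R2
`degOneSpan_of_isEdgeData_alg`), then EVERY typed core focus `Ě` of EVERY realized member has REGULAR `Sing(Ě)` — SEAT 2's p504522
`isRegular_sing_of_Thm6_14_1_of_dim_le` read through §2. [folklore] -/
theorem isRegular_sing_of_thm614Part1On
    (hle : ∀ (F : IdealExponent A.Z) (S : Set A.Z), 𝒞 F S → DimUscClosureClass F S)
    (hspan : ∀ (F : IdealExponent A.Z) (η : A.Z) (D : EdgeDatumAt p n F η), IsEdgeData' F η D →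
      ∀ b ∈ stalkIdeal (pAlg F 1) η, b ∈ maximalIdeal (A.Z.presheaf.stalk η) →
        ∃ c : Fin D.r → A.Z.presheaf.stalk η, (∀ j, D.expo j ≠ 0 → c j = 0) ∧
          b - ∑ j, c j * D.g j ∈ maximalIdeal (A.Z.presheaf.stalk η) ^ 2)
    (h : Thm614Part1On 𝒞 IsEdgeData IsEdgeData' A n)
    (E : IdealExponent A.Z) (ed : EdgeDataOn p n (baseHike E)) (hE : E.IsStandard) (hb : 0 < (baseHike E).b)
    (hed : IsEdgeDataOn IsEdgeData (baseHike E) ed)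
    (hC : 𝒞 (baseHike E) (invmaxStratum ((baseHike E).sing ∩ S02Preliminaries.closedPoints A.Z) (invField (baseHike E) ed)))
    {Echeck : IdealExponent A.Z} (hEc : IsCoreFocus_inst (baseHike E) Echeck ed) :
    Scheme.IsRegular (vanishingIdeal (⟨Echeck.sing, A.isClosed_sing Echeck⟩ : Closeds A.Z)).subscheme :=
  have hcf : IsCoreFocus S04CharAlgebra.pAlg (invInst (baseHike E) ed) (baseHike E) Echeck := hEc
  isRegular_sing_of_Thm6_14_1_of_dim_le A n (invInst (baseHike E) ed)
    (fun F G => IsCoreFocus S04CharAlgebra.pAlg (invInst (baseHike E) ed) F G) E Echeck hE hEc hb hcf (IsEdgeData' Echeck)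
    (hspan Echeck) ((dimUscClosureClass_iff_of_isCoreFocus_inst A (baseHike E) ed hEc).mp (hle _ _ hC))
    (h E ed hE hb hed hC Echeck hEc)

/-- **NECESSITY for the residual**: with the door `CoreFocusExistsOn 𝒞` (p487786; PROVED on `LCIOrMonomialClass`, p494780) supplying a typed core
focus, 20a on `𝒞 ≤ DimUscClosureClass` forces ⟨HatClosureRegular⟩ on `𝒞` (`Σ̄_max(Ê) = Sing(Ě)`, p498576 §1). [folklore] -/
theorem hatClosureRegularOn_of_thm614Part1On
    (hle : ∀ (F : IdealExponent A.Z) (S : Set A.Z), 𝒞 F S → DimUscClosureClass F S)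
    (hspan : ∀ (F : IdealExponent A.Z) (η : A.Z) (D : EdgeDatumAt p n F η), IsEdgeData' F η D →
      ∀ b ∈ stalkIdeal (pAlg F 1) η, b ∈ maximalIdeal (A.Z.presheaf.stalk η) →
        ∃ c : Fin D.r → A.Z.presheaf.stalk η, (∀ j, D.expo j ≠ 0 → c j = 0) ∧
          b - ∑ j, c j * D.g j ∈ maximalIdeal (A.Z.presheaf.stalk η) ^ 2)
    (hex : CoreFocusExistsOn 𝒞 IsEdgeData A n) (h : Thm614Part1On 𝒞 IsEdgeData IsEdgeData' A n) :
    HatClosureRegularOn 𝒞 IsEdgeData A n := by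
  intro E ed hE hb hed hC
  obtain ⟨Echeck, hEc⟩ := hex E ed hE hb hed hC
  exact (CampaignW31.invmaxClosureRegularOn_iff_isRegular_sing_of_isCoreFocus_inst A (baseHike E) ed hEc).mpr
    (isRegular_sing_of_thm614Part1On hle hspan h E ed hE hb hed hC hEc)

/-- **20a IS EXACT ON THE CLASS — ⟨HatClosureRegular⟩ form.** For `𝒞 ≤ DimUscClosureClass` (at the ambient scheme) carrying the door, and a reading
`IsEdgeData'` implied by R1 ∧ R2 (`hread`, p493712) with degree-one spanning (`hspan`, p502486/p504522):
`Thm614Part1On 𝒞 IsEdgeData IsEdgeData' ⟺ HatClosureRegularOn 𝒞 IsEdgeData` (⇐ = p501108 `thm614Part1On_of_hatClosureRegularOn`). [folklore] -/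
theorem thm614Part1On_iff_hatClosureRegularOn
    (hle : ∀ (F : IdealExponent A.Z) (S : Set A.Z), 𝒞 F S → DimUscClosureClass F S)
    (hex : CoreFocusExistsOn 𝒞 IsEdgeData A n)
    (hread : ∀ (F : IdealExponent A.Z) (η : A.Z) (D : EdgeDatumAt p n F η),
      S04CharAlgebra.IsEdgeData D → IsEdgeData_alg D → IsEdgeData' F η D)
    (hspan : ∀ (F : IdealExponent A.Z) (η : A.Z) (D : EdgeDatumAt p n F η), IsEdgeData' F η D →
      ∀ b ∈ stalkIdeal (pAlg F 1) η, b ∈ maximalIdeal (A.Z.presheaf.stalk η) →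
        ∃ c : Fin D.r → A.Z.presheaf.stalk η, (∀ j, D.expo j ≠ 0 → c j = 0) ∧
          b - ∑ j, c j * D.g j ∈ maximalIdeal (A.Z.presheaf.stalk η) ^ 2) :
    Thm614Part1On 𝒞 IsEdgeData IsEdgeData' A n ↔ HatClosureRegularOn 𝒞 IsEdgeData A n :=
  ⟨hatClosureRegularOn_of_thm614Part1On hle hspan hex, thm614Part1On_of_hatClosureRegularOn hread⟩

/-- **20a IS EXACT ON THE CLASS — R20 form** («`Ě` exists with regular `Sing(Ě)`»). [folklore] -/
theorem thm614Part1On_iff_coreFocusSingRegularOn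
    (hle : ∀ (F : IdealExponent A.Z) (S : Set A.Z), 𝒞 F S → DimUscClosureClass F S)
    (hex : CoreFocusExistsOn 𝒞 IsEdgeData A n)
    (hread : ∀ (F : IdealExponent A.Z) (η : A.Z) (D : EdgeDatumAt p n F η),
      S04CharAlgebra.IsEdgeData D → IsEdgeData_alg D → IsEdgeData' F η D)
    (hspan : ∀ (F : IdealExponent A.Z) (η : A.Z) (D : EdgeDatumAt p n F η), IsEdgeData' F η D →
      ∀ b ∈ stalkIdeal (pAlg F 1) η, b ∈ maximalIdeal (A.Z.presheaf.stalk η) →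
        ∃ c : Fin D.r → A.Z.presheaf.stalk η, (∀ j, D.expo j ≠ 0 → c j = 0) ∧
          b - ∑ j, c j * D.g j ∈ maximalIdeal (A.Z.presheaf.stalk η) ^ 2) :
    Thm614Part1On 𝒞 IsEdgeData IsEdgeData' A n ↔ CoreFocusSingRegularOn 𝒞 IsEdgeData A n :=
  ⟨fun h E ed hE hb hed hC => by
      obtain ⟨Echeck, hEc⟩ := hex E ed hE hb hed hC
      exact ⟨Echeck, hEc, isRegular_sing_of_thm614Part1On hle hspan h E ed hE hb hed hC hEc⟩,
    fun h => thm614Part1On_of_hatClosureRegularOn hread (hatClosureRegularOn_of_coreFocusSingRegularOn h)⟩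

/-! ## §4 The DNF-half carrier: one member with singular `Σ̄_max` (of upper semicontinuous local dimension) -/

/-- **ONE MEMBER KILLS 20a ON THE CLASS.** A realized member `(E, ed)` of `𝒞` (standard, `0 < Ê.b`, certified in `IsEdgeData`) with
`DimUscClosureClass Ê Σ_max`, together with a typed core focus `Ě` of it whose `Sing(Ě)` is NOT regular, refutes `Thm614Part1On 𝒞 IsEdgeData IsEdgeData'`
for every reading `IsEdgeData'` with degree-one spanning — SEAT 2's necessity, contraposed. (SEAT 1's cross is pre-declared to be such a member of
`LCIClass` at `p = 2`; uncertified as a member until its files land.) [folklore] -/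
theorem not_thm614Part1On_of_member
    (hspan : ∀ (F : IdealExponent A.Z) (η : A.Z) (D : EdgeDatumAt p n F η), IsEdgeData' F η D →
      ∀ b ∈ stalkIdeal (pAlg F 1) η, b ∈ maximalIdeal (A.Z.presheaf.stalk η) →
        ∃ c : Fin D.r → A.Z.presheaf.stalk η, (∀ j, D.expo j ≠ 0 → c j = 0) ∧
          b - ∑ j, c j * D.g j ∈ maximalIdeal (A.Z.presheaf.stalk η) ^ 2)
    (E : IdealExponent A.Z) (ed : EdgeDataOn p n (baseHike E)) (hE : E.IsStandard) (hb : 0 < (baseHike E).b)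
    (hed : IsEdgeDataOn IsEdgeData (baseHike E) ed)
    (hC : 𝒞 (baseHike E) (invmaxStratum ((baseHike E).sing ∩ S02Preliminaries.closedPoints A.Z) (invField (baseHike E) ed)))
    (hdimle : DimUscClosureClass (baseHike E)
      (invmaxStratum ((baseHike E).sing ∩ S02Preliminaries.closedPoints A.Z) (invField (baseHike E) ed)))
    {Echeck : IdealExponent A.Z} (hEc : IsCoreFocus_inst (baseHike E) Echeck ed)
    (hsing : ¬ Scheme.IsRegular (vanishingIdeal (⟨Echeck.sing, A.isClosed_sing Echeck⟩ : Closeds A.Z)).subscheme) :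
    ¬ Thm614Part1On 𝒞 IsEdgeData IsEdgeData' A n := fun h =>
  hsing (isRegular_sing_of_thm614Part1On (𝒞 := DimUscPart 𝒞) (fun _ _ h' => h'.2) hspan
    (thm614Part1On_mono (fun _ _ _ h' => h'.1) h) E ed hE hb hed ⟨hC, hdimle⟩ hEc)

end Exact

end CampaignW36

open CampaignW36

/-! ## §5 The `p`-slices (binder-free) -/

/-- **ONE MEMBER KILLS BOTH `p`-SLICES OF 20a ON THE CLASS** (R1 and R2 readings of the produced data): a realized member of `𝒞` over SOME perfect
field of characteristic `p` (input provenance `CampaignW31.edgeDataProvenance`), with `Σ̄_max(Ê)` in `DimUscClosureClass` and a typed core focus with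
NON-regular `Sing(Ě)`, gives `¬ CampaignW36Thm614Part1OnI 𝒞 p ∧ ¬ CampaignW36Thm614Part1OnR2I 𝒞 p`. NOT a statement of the manuscript. [folklore] -/
theorem not_campaignW36Thm614Part1OnI_of_member (𝒞 : ∀ ⦃W : Scheme.{u}⦄, IdealExponent W → Set W → Prop) (p : ℕ) [Fact p.Prime]
    (K : Type u) [Field K] [CharP K p] [PerfectField K] (A : AmbientDatum p K) (n : ℕ) (E : IdealExponent A.Z)
    (ed : EdgeDataOn p n (baseHike E)) (hE : E.IsStandard) (hb : 0 < (baseHike E).b)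
    (hed : IsEdgeDataOn CampaignW31.edgeDataProvenance (baseHike E) ed)
    (hC : 𝒞 (baseHike E) (invmaxStratum ((baseHike E).sing ∩ S02Preliminaries.closedPoints A.Z) (invField (baseHike E) ed)))
    (hdimle : DimUscClosureClass (baseHike E)
      (invmaxStratum ((baseHike E).sing ∩ S02Preliminaries.closedPoints A.Z) (invField (baseHike E) ed)))
    {Echeck : IdealExponent A.Z} (hEc : IsCoreFocus_inst (baseHike E) Echeck ed)
    (hsing : ¬ Scheme.IsRegular (vanishingIdeal (⟨Echeck.sing, A.isClosed_sing Echeck⟩ : Closeds A.Z)).subscheme) :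
    ¬ CampaignW36Thm614Part1OnI.{u} 𝒞 p ∧ ¬ CampaignW36Thm614Part1OnR2I.{u} 𝒞 p :=
  ⟨fun h => not_thm614Part1On_of_member (fun _ _ D hD => D.degOneSpan_of_isEdgeData hD) E ed hE hb hed hC hdimle hEc hsing
      (h K A n),
    fun h => not_thm614Part1On_of_member (fun _ _ D hD => D.degOneSpan_of_isEdgeData_alg hD) E ed hE hb hed hC hdimle hEc hsing
      (h K A n)⟩

/-- **THE CARRIER WITHOUT NAMING `Ě`**: a realized member of `𝒞` inside the door's class `LCIOrMonomialClass` (so the door p494780 supplies a typed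
core focus) whose `Σ̄_max(Ê)` is in `DimUscClosureClass` and NOT regular (`¬ CampaignW31.InvmaxClosureRegularOn`) kills both `p`-slices of 20a on `𝒞`.
NOT a statement of the manuscript. [folklore] -/
theorem not_campaignW36Thm614Part1OnI_of_singular_closure (𝒞 : ∀ ⦃W : Scheme.{u}⦄, IdealExponent W → Set W → Prop) (p : ℕ)
    [Fact p.Prime] (K : Type u) [Field K] [CharP K p] [PerfectField K] (A : AmbientDatum p K) (n : ℕ) (E : IdealExponent A.Z)
    (ed : EdgeDataOn p n (baseHike E)) (hE : E.IsStandard) (hb : 0 < (baseHike E).b)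
    (hed : IsEdgeDataOn CampaignW31.edgeDataProvenance (baseHike E) ed)
    (hC : 𝒞 (baseHike E) (invmaxStratum ((baseHike E).sing ∩ S02Preliminaries.closedPoints A.Z) (invField (baseHike E) ed)))
    (hlm : LCIOrMonomialClass (baseHike E)
      (invmaxStratum ((baseHike E).sing ∩ S02Preliminaries.closedPoints A.Z) (invField (baseHike E) ed)))
    (hdimle : DimUscClosureClass (baseHike E)
      (invmaxStratum ((baseHike E).sing ∩ S02Preliminaries.closedPoints A.Z) (invField (baseHike E) ed)))
    (hsing : ¬ CampaignW31.InvmaxClosureRegularOn ((baseHike E).sing ∩ S02Preliminaries.closedPoints A.Z)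
      (invField (baseHike E) ed)) :
    ¬ CampaignW36Thm614Part1OnI.{u} 𝒞 p ∧ ¬ CampaignW36Thm614Part1OnR2I.{u} 𝒞 p := by
  obtain ⟨Echeck, hEc⟩ := campaignW36CoreFocusExists_lciOrMonomial_holds p K A n E ed hE hb hed hlm
  exact not_campaignW36Thm614Part1OnI_of_member 𝒞 p K A n E ed hE hb hed hC hdimle hEc fun hreg =>
    hsing ((CampaignW31.invmaxClosureRegularOn_iff_isRegular_sing_of_isCoreFocus_inst A (baseHike E) ed hEc).mpr hreg)

/-- **SEAT 1's SHAPE (`𝒞 := LCIClass`)**: an A-type member (`LCIClass Ê Σ_max`, e.g. `Σ̄_max` a singular complete-intersection cut such as the cross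
`V(z, xy) ⊂ 𝔸³`) with NON-regular `Σ̄_max(Ê)` of upper semicontinuous local dimension, over some perfect `K` of characteristic `p`, gives
`¬ CampaignW36Thm614Part1OnI LCIClass p ∧ ¬ CampaignW36Thm614Part1OnR2I LCIClass p` — 20a|`LCIClass` DOES-NOT-FOLLOW-AS-TYPED at that instance, by name.
NOT a statement of the manuscript; no member is certified IN THIS FILE. [folklore] -/
theorem not_campaignW36Thm614Part1OnI_lciClass_of_singular_closure (p : ℕ) [Fact p.Prime] (K : Type u) [Field K] [CharP K p]
    [PerfectField K] (A : AmbientDatum p K) (n : ℕ) (E : IdealExponent A.Z) (ed : EdgeDataOn p n (baseHike E)) (hE : E.IsStandard)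
    (hb : 0 < (baseHike E).b) (hed : IsEdgeDataOn CampaignW31.edgeDataProvenance (baseHike E) ed)
    (hC : LCIClass (baseHike E) (invmaxStratum ((baseHike E).sing ∩ S02Preliminaries.closedPoints A.Z) (invField (baseHike E) ed)))
    (hdimle : DimUscClosureClass (baseHike E)
      (invmaxStratum ((baseHike E).sing ∩ S02Preliminaries.closedPoints A.Z) (invField (baseHike E) ed)))
    (hsing : ¬ CampaignW31.InvmaxClosureRegularOn ((baseHike E).sing ∩ S02Preliminaries.closedPoints A.Z)
      (invField (baseHike E) ed)) :
    ¬ CampaignW36Thm614Part1OnI.{u} LCIClass p ∧ ¬ CampaignW36Thm614Part1OnR2I.{u} LCIClass p :=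
  not_campaignW36Thm614Part1OnI_of_singular_closure LCIClass p K A n E ed hE hb hed hC (lciClass_le _ _ hC) hdimle hsing

/-- **20a IS EXACT, `p`-SLICES, for every class inside `DimUscClosureClass` carrying the door** (`CampaignW36CoreFocusExistsOnI 𝒞 p`, p487786): both
readings of the produced data agree with ⟨HatClosureRegular⟩ on the class. NOT a statement of the manuscript. [folklore] -/
theorem campaignW36Thm614Part1OnI_iff_hatClosureRegularOnI (𝒞 : ∀ ⦃W : Scheme.{u}⦄, IdealExponent W → Set W → Prop) (p : ℕ)
    [Fact p.Prime] (hle : ∀ ⦃W⦄ (F : IdealExponent W) (S : Set W), 𝒞 F S → DimUscClosureClass F S)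
    (hdoor : CampaignW36CoreFocusExistsOnI.{u} 𝒞 p) :
    (CampaignW36Thm614Part1OnI.{u} 𝒞 p ↔ CampaignW36HatClosureRegularOnI.{u} 𝒞 p) ∧
      (CampaignW36Thm614Part1OnR2I.{u} 𝒞 p ↔ CampaignW36HatClosureRegularOnI.{u} 𝒞 p) :=
  ⟨⟨fun h K _ _ _ A n => hatClosureRegularOn_of_thm614Part1On (fun F S hC => hle F S hC)
      (fun _ _ D hD => D.degOneSpan_of_isEdgeData hD) (hdoor K A n) (h K A n),
    fun h => (campaignW36Thm614Part1OnI_of_hatClosureRegularOnI 𝒞 p h).1⟩,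
   ⟨fun h K _ _ _ A n => hatClosureRegularOn_of_thm614Part1On (fun F S hC => hle F S hC)
      (fun _ _ D hD => D.degOneSpan_of_isEdgeData_alg hD) (hdoor K A n) (h K A n),
    fun h => (campaignW36Thm614Part1OnI_of_hatClosureRegularOnI 𝒞 p h).2⟩⟩

/-- **… and with R20's regime** («`Ě` exists with regular `Sing(Ě)`» on `𝒞`, p498576's unconditional bridge `campaignW36CoreFocusSingRegularOnI_iff`).
NOT a statement of the manuscript. [folklore] -/
theorem campaignW36Thm614Part1OnI_iff_coreFocusSingRegularOnI (𝒞 : ∀ ⦃W : Scheme.{u}⦄, IdealExponent W → Set W → Prop) (p : ℕ)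
    [Fact p.Prime] (hle : ∀ ⦃W⦄ (F : IdealExponent W) (S : Set W), 𝒞 F S → DimUscClosureClass F S)
    (hdoor : CampaignW36CoreFocusExistsOnI.{u} 𝒞 p) :
    CampaignW36Thm614Part1OnI.{u} 𝒞 p ↔ CampaignW36CoreFocusSingRegularOnI.{u} 𝒞 p :=
  (campaignW36Thm614Part1OnI_iff_hatClosureRegularOnI 𝒞 p hle hdoor).1.trans (campaignW36CoreFocusSingRegularOnI_iff 𝒞 p).symm

/-- **UNCONDITIONAL on the `DimUsc`-part of every sub-class of the door's class**: for `𝒞 ≤ LCIOrMonomialClass` (door p494780),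
`CampaignW36Thm614Part1OnI (DimUscPart 𝒞) p ↔ CampaignW36HatClosureRegularOnI (DimUscPart 𝒞) p` and the same for the R2I slice — in particular on
`DimUscPart LCIClass` (`lciClass_le`) and `DimUscPart LCIOrMonomialClass`. NOT a statement of the manuscript. [folklore] -/
theorem campaignW36Thm614Part1OnI_dimUscPart_iff (𝒞 : ∀ ⦃W : Scheme.{u}⦄, IdealExponent W → Set W → Prop) (p : ℕ) [Fact p.Prime]
    (hlm : ∀ ⦃W⦄ (F : IdealExponent W) (S : Set W), 𝒞 F S → LCIOrMonomialClass F S) :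
    (CampaignW36Thm614Part1OnI.{u} (DimUscPart 𝒞) p ↔ CampaignW36HatClosureRegularOnI.{u} (DimUscPart 𝒞) p) ∧
      (CampaignW36Thm614Part1OnR2I.{u} (DimUscPart 𝒞) p ↔ CampaignW36HatClosureRegularOnI.{u} (DimUscPart 𝒞) p) :=
  campaignW36Thm614Part1OnI_iff_hatClosureRegularOnI (DimUscPart 𝒞) p (fun _ _ _ h => h.2) fun K _ _ _ A n =>
    coreFocusExistsOn_mono (fun _ F S h => hlm F S h.1) (campaignW36CoreFocusExists_lciOrMonomial_holds p K A n)

/-- **UNCONDITIONAL on `DimUscPart LCIClass`** (the A-type class of p488503, where SEAT 1's cross lives). NOT a statement of the manuscript. [folklore] -/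
theorem campaignW36Thm614Part1OnI_dimUscPart_lciClass_iff (p : ℕ) [Fact p.Prime] :
    (CampaignW36Thm614Part1OnI.{u} (DimUscPart LCIClass) p ↔ CampaignW36HatClosureRegularOnI.{u} (DimUscPart LCIClass) p) ∧
      (CampaignW36Thm614Part1OnR2I.{u} (DimUscPart LCIClass) p ↔
        CampaignW36HatClosureRegularOnI.{u} (DimUscPart LCIClass) p) :=
  campaignW36Thm614Part1OnI_dimUscPart_iff LCIClass p lciClass_le

/-- **UNCONDITIONAL on every sub-class of the door's class with IRREDUCIBLE `Σ̄_max`** (no dimension guard: SEAT 2's p503626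
`ringKrullDim_quotient_stalkIdeal_eq_of_irreducible`). NOT a statement of the manuscript. [folklore] -/
theorem campaignW36Thm614Part1OnI_iff_of_irreducible (𝒞 : ∀ ⦃W : Scheme.{u}⦄, IdealExponent W → Set W → Prop) (p : ℕ)
    [Fact p.Prime] (hirr : ∀ ⦃W⦄ (F : IdealExponent W) (S : Set W), 𝒞 F S → IrreducibleClosureClass F S)
    (hlm : ∀ ⦃W⦄ (F : IdealExponent W) (S : Set W), 𝒞 F S → LCIOrMonomialClass F S) :
    (CampaignW36Thm614Part1OnI.{u} 𝒞 p ↔ CampaignW36HatClosureRegularOnI.{u} 𝒞 p) ∧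
      (CampaignW36Thm614Part1OnR2I.{u} 𝒞 p ↔ CampaignW36HatClosureRegularOnI.{u} 𝒞 p) :=
  ⟨⟨fun h K _ _ _ A n => hatClosureRegularOn_of_thm614Part1On
      (fun F S hC => dimUscClosureClass_of_irreducibleClosureClass A F S (hirr F S hC))
      (fun _ _ D hD => D.degOneSpan_of_isEdgeData hD)
      (coreFocusExistsOn_mono hlm (campaignW36CoreFocusExists_lciOrMonomial_holds p K A n)) (h K A n),
    fun h => (campaignW36Thm614Part1OnI_of_hatClosureRegularOnI 𝒞 p h).1⟩,
   ⟨fun h K _ _ _ A n => hatClosureRegularOn_of_thm614Part1On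
      (fun F S hC => dimUscClosureClass_of_irreducibleClosureClass A F S (hirr F S hC))
      (fun _ _ D hD => D.degOneSpan_of_isEdgeData_alg hD)
      (coreFocusExistsOn_mono hlm (campaignW36CoreFocusExists_lciOrMonomial_holds p K A n)) (h K A n),
    fun h => (campaignW36Thm614Part1OnI_of_hatClosureRegularOnI 𝒞 p h).2⟩⟩

end Summit.ResolutionOfSingularities.ResolutionOfSingularities.Theorems

end
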